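import Summits.QuantumFields.YangMills.Theorems.TwistedTraceScaling.Negative.CentralEuclideanRadiusWindow
import HarnessLib

/-!
# Negative lemma R48 (cdisprove g40) — the (4′) chart→slice TRANSFER EXPONENT on the window of the landed one-radius (C1) glue
# (crux `TwistedTraceScaling` stmt-QuantumFields-20203, skeleton «twolattice»; vets lane A g18's `…BOChartSliceTransfer.chart_rep_transfer` (landed 2026-08-29) against
# `…BOCentralTube.central_transfer_two_sided_of_localisedAvg_local` = p686369, the landed relative-local (C1) glue with ONE scale `T` and ONE radius `R`)

Lane A's (4′) transfer (`chart_rep_transfer`, SOUND as stated) moves the stiff exponent from the chart coordinate to the slice representative at the price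
`ε_tr = (96t+b)·(D′(2‖x*‖+D′) + 72|E|ρ³) ≥ (96t+b)·72|E|ρ³`, which at the record exponent `q = stiffGaussExp L (β/2) β` (`t = β/2`, `b = β`, so `96t+b = 49β`) is
`≥ 3528·|E|·β·ρ³ = 10584·L³·β·ρ³` (`|E| = 3L³`, `FemtoTransferGap.card_edge_three`; §1); the (C1c′) chart suppliers built on it (`localisedAvg_chart_upper/lower`, lane A HANDOFF-g18) carry `e^{±(ε_q+ε_tr)}`.
* §2 ★★★ `chartTransferEps_pow_four_gt` / `chartTransferEps_gt` (pure arithmetic): `8T ≤ ρ` (the glue's `hTρ`) and `9L³·log 2 < 84100·T⁴·β` (R47W `window_euclid`: forced by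
  `hAlo` with some `gm > 0` AND an informative lower constant) give `(10584L³βρ³)⁴ > 4000⁴·L²¹·β`, hence `ε_tr > 4000·L^{21/4}·β^{1/4} ≥ 4000` for `β ≥ 1`.
* §3 ★★★ `chartTransfer_wide_of_window` / `chartTransfer_wide_of_hAlo`: the same from `window_euclid`'s hypotheses resp. from the glue's hypotheses VERBATIM (`hΩt`, `hWc`, a centre,
  `hAlo` with `gm > 0`, informativeness): on every parameter choice for which the landed one-radius glue is both satisfiable and informative, the two constants of the (4′) chart
  supplier differ by a factor `≥ e^{2ε_tr} > e^{8000}` — and `ε_tr → ∞` like `β^{1/4}`, whereas S-BASE needs `ε_tr → 0` (indeed `o(β^{-1/6})` for (B-OD), `o(β^{-1/3})` for (B-T)).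
  This complements R47W (`glue_rate_gt_of_hAlo`: transport envelope `> 300L⁶` there) from the SUPPLIER side: not only the glue's transport constants but also its `hAhi/hAlo` inputs
  are unboundedly wide on that window.
* §4 `chartTransferEps_le_of_schedule` (no bite on the DECOUPLED restatement, lane A COARSE-DESIGN §28.3 (ii)/§28.6): with `ρ ≤ c/√β` (schedule B: `c = 60Lℓ²`, i.e. `ρ = 8T_W`,
  `T_W ≈ 7.5Lβ^{-1/2}ℓ²`) one has `10584L³βρ³ ≤ 10584L³c³/√β` (`≈ 2.3·10⁹·L⁶ℓ⁶·β^{-1/2} → 0` at fixed `L`; `≤ 1` once `β ≥ 5.2·10¹⁸L¹²ℓ¹²`, `o(β^{-1/6})` eventually): a fixed-`L`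
  threshold, not a kill (Disproof.lean VERDICT).
READING: a constraint on the unbuilt (C1c′)/(C1) assembly — the chart radius `ρ` must be decoupled from every scale that informativeness pushes above `β^{-1/2}·polylog`
(here `T ≥ 0.09L^{3/4}β^{-1/4}` via `hTρ`); nothing landed is wrong.
HONEST FRAMING: negative/boundary lemmas (helper, `--supports stmt-QuantumFields-20203`) about hypotheses of bricks of a stub (S-BASE) of a child of the CONDITIONAL reduction
route R2b1; nothing here refutes or proves `TwistedTraceScaling`, S-BASE, (B-OD) or C4-CORE; not infinite volume, not a gap, not Clay. bears_on R2b1.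
-/

set_option autoImplicit false

noncomputable section

open MeasureTheory Filter Topology Real
open scoped BigOperators RealInnerProductSpace Quaternion
open Literature.MathematicalPhysics.QuantumFieldTheory hiding SU2
open Literature.MathematicalPhysics.QuantumLattice

namespace Summit.QuantumFields.YangMills.Theorems.TwistedTraceScaling.Negative.R48

open Summit.QuantumFields.YangMills.Theorems.FemtoTransferGap
open Summit.QuantumFields.YangMills.Theorems.FemtoTransferGap.TwoLattice
open Summit.QuantumFields.YangMills.Theorems.FemtoTransferGap.TwoLattice.Avg
open Summit.QuantumFields.YangMills.Theorems.FemtoTransferGap.TwoLattice.ConstTube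
open Summit.QuantumFields.YangMills.Theorems.FemtoTransferGap.TwoLattice.Stiff
open Summit.QuantumFields.YangMills.Theorems.FemtoTransferGap.TwoLattice.GnChart
open Summit.QuantumFields.YangMills.Theorems.TwistedTraceScaling.Negative.R47W
open Literature.MathematicalPhysics.QuantumFieldTheory.Balaban1983to89.T4HaarSU2Translate renaming su2Quat_mul → su2Quat_mul₄, su2Quat_one → su2Quat_one₄

variable {L : ℕ} [NeZero L]

/-! ## §1 The size of the (4′) transfer exponent at the record scales -/

/-- The `ρ³` part of the (4′) transfer exponent at `t = β/2`, `b = β`: `(96·(β/2)+β)·(72|E|ρ³) = 10584·L³·β·ρ³`. [folklore] -/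
theorem chartTransferEps_eq (β ρ : ℝ) :
    (96 * (β / 2) + β) * (72 * Fintype.card (Edge 3 L) * ρ ^ 3) = 10584 * (L : ℝ) ^ 3 * β * ρ ^ 3 := by
  rw [FemtoTransferGap.card_edge_three (L := L)]; push_cast; ring

/-- The full (4′) error term dominates its `ρ³` part: for `D′ ≥ 0`, `x ≥ 0`, `β ≥ 0`,
`10584·L³βρ³ ≤ (96·(β/2)+β)·(D′(2x+D′) + 72|E|ρ³)`. [folklore] -/
theorem chartTransferEps_le_full {β ρ D x : ℝ} (hβ : 0 ≤ β) (hD : 0 ≤ D) (hx : 0 ≤ x) :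
    10584 * (L : ℝ) ^ 3 * β * ρ ^ 3 ≤ (96 * (β / 2) + β) * (D * (2 * x + D) + 72 * Fintype.card (Edge 3 L) * ρ ^ 3) := by
  rw [mul_add, chartTransferEps_eq]
  have : 0 ≤ (96 * (β / 2) + β) * (D * (2 * x + D)) := by positivity
  linarith

/-! ## §2 ★★★ Pure arithmetic: `8T ≤ ρ` and `9L³log 2 < 84100T⁴β` force `ε_tr > 4000·L^{21/4}β^{1/4}` -/

/-- ★★★ **Fourth-power form.**  `β > 0`, `T ≥ 0`, `8T ≤ ρ`, `9L³·log 2 < 84100·T⁴·β` ⟹ `4000⁴·L²¹·β < (10584·L³·β·ρ³)⁴`. [folklore] -/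
theorem chartTransferEps_pow_four_gt {β T ρ : ℝ} (hβ : 0 < β) (hT0 : 0 ≤ T) (hTρ : 8 * T ≤ ρ)
    (hwin : 9 * (L : ℝ) ^ 3 * Real.log 2 < 84100 * T ^ 4 * β) :
    (4000 : ℝ) ^ 4 * (L : ℝ) ^ 21 * β < (10584 * (L : ℝ) ^ 3 * β * ρ ^ 3) ^ 4 := by
  have hL1 : (1 : ℝ) ≤ (L : ℝ) := by exact_mod_cast NeZero.one_le
  have hL0 : (0 : ℝ) < (L : ℝ) := by linarith
  have h8 : (8 * T) ^ 3 ≤ ρ ^ 3 := pow_le_pow_left₀ (by positivity) hTρ 3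
  have hc0 : (0 : ℝ) ≤ 10584 * (L : ℝ) ^ 3 * β := by positivity
  have hFE : 5419008 * (L : ℝ) ^ 3 * β * T ^ 3 ≤ 10584 * (L : ℝ) ^ 3 * β * ρ ^ 3 := by
    have h := mul_le_mul_of_nonneg_left h8 hc0
    calc 5419008 * (L : ℝ) ^ 3 * β * T ^ 3 = 10584 * (L : ℝ) ^ 3 * β * (8 * T) ^ 3 := by ring
      _ ≤ 10584 * (L : ℝ) ^ 3 * β * ρ ^ 3 := h
  have hF0 : 0 ≤ 5419008 * (L : ℝ) ^ 3 * β * T ^ 3 := by positivity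
  have hFE4 : (5419008 * (L : ℝ) ^ 3 * β * T ^ 3) ^ 4 ≤ (10584 * (L : ℝ) ^ 3 * β * ρ ^ 3) ^ 4 := pow_le_pow_left₀ hF0 hFE 4
  have hlog : (0.6931471803 : ℝ) < Real.log 2 := Real.log_two_gt_d9
  have hw' : 9 * (L : ℝ) ^ 3 * 0.6931471803 < 84100 * T ^ 4 * β := by
    have : 9 * (L : ℝ) ^ 3 * 0.6931471803 ≤ 9 * (L : ℝ) ^ 3 * Real.log 2 :=
      mul_le_mul_of_nonneg_left hlog.le (by positivity)
    exact lt_of_le_of_lt this hwin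
  have hcube : (9 * (L : ℝ) ^ 3 * 0.6931471803) ^ 3 < (84100 * T ^ 4 * β) ^ 3 :=
    pow_lt_pow_left₀ hw' (by positivity) three_ne_zero
  have hnum : (4000 : ℝ) ^ 4 < 5419008 ^ 4 / 84100 ^ 3 * (729 * 0.6931471803 ^ 3) := by norm_num
  have hLβ : 0 < (L : ℝ) ^ 21 * β := by positivity
  have hpos : 0 < 5419008 ^ 4 / 84100 ^ 3 * (L : ℝ) ^ 12 * β := by positivity
  have key : (4000 : ℝ) ^ 4 * (L : ℝ) ^ 21 * β < (5419008 * (L : ℝ) ^ 3 * β * T ^ 3) ^ 4 :=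
    calc (4000 : ℝ) ^ 4 * (L : ℝ) ^ 21 * β = (4000 : ℝ) ^ 4 * ((L : ℝ) ^ 21 * β) := by ring
      _ < 5419008 ^ 4 / 84100 ^ 3 * (729 * 0.6931471803 ^ 3) * ((L : ℝ) ^ 21 * β) := mul_lt_mul_of_pos_right hnum hLβ
      _ = 5419008 ^ 4 / 84100 ^ 3 * (L : ℝ) ^ 12 * β * (9 * (L : ℝ) ^ 3 * 0.6931471803) ^ 3 := by ring
      _ < 5419008 ^ 4 / 84100 ^ 3 * (L : ℝ) ^ 12 * β * (84100 * T ^ 4 * β) ^ 3 := mul_lt_mul_of_pos_left hcube hpos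
      _ = (5419008 * (L : ℝ) ^ 3 * β * T ^ 3) ^ 4 := by ring
  exact key.trans_le hFE4

/-- ★★★ **`ε_tr > 4000`.**  With moreover `β ≥ 1`: `4000 < 10584·L³·β·ρ³ ≤ ε_tr`. [folklore] -/
theorem chartTransferEps_gt {β T ρ : ℝ} (hβ1 : 1 ≤ β) (hT0 : 0 ≤ T) (hTρ : 8 * T ≤ ρ)
    (hwin : 9 * (L : ℝ) ^ 3 * Real.log 2 < 84100 * T ^ 4 * β) :
    (4000 : ℝ) < 10584 * (L : ℝ) ^ 3 * β * ρ ^ 3 := by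
  have hβ : 0 < β := by linarith
  have hL1 : (1 : ℝ) ≤ (L : ℝ) := by exact_mod_cast NeZero.one_le
  have h4 := chartTransferEps_pow_four_gt (L := L) hβ hT0 hTρ hwin
  have hρ0 : 0 ≤ ρ := le_trans (by positivity) hTρ
  have hE0 : 0 ≤ 10584 * (L : ℝ) ^ 3 * β * ρ ^ 3 := by positivity
  have hL21 : (1 : ℝ) ≤ (L : ℝ) ^ 21 * β := one_le_mul_of_one_le_of_one_le (one_le_pow₀ hL1) hβ1
  have h1 : (4000 : ℝ) ^ 4 ≤ (4000 : ℝ) ^ 4 * (L : ℝ) ^ 21 * β := by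
    have := mul_le_mul_of_nonneg_left hL21 (by norm_num : (0 : ℝ) ≤ 4000 ^ 4)
    linarith [this]
  exact lt_of_pow_lt_pow_left₀ 4 hE0 (h1.trans_lt h4)

/-! ## §3 ★★★ On the window of the landed one-radius glue the (4′) supplier is `> e^{8000}` wide -/

/-- ★★★ **From `window_euclid`'s hypotheses** (the parameters of `…central_transfer_two_sided_of_localisedAvg_local`: `β ≥ 1`, `0 ≤ T ≤ 1/30`, `8T ≤ ρ`, `0 ≤ R`, `6T²R ≤ R₀`;
`hAlo` with some `gm > 0` in its arithmetic form `7·min(ρ,R₀−R) ≤ 48R + 400T²` (R47W `not_hAloLocal_glue_euclid`); informative lower constant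
`|E×3|·log 2 + 98βR² < min(ρ−2T, R₀−6T²R)²β` (R46L)): for all `D′, x ≥ 0` the (4′) transfer exponent `(96·(β/2)+β)(D′(2x+D′) + 72|E|ρ³)` exceeds `4000`, and its `ρ³` part
alone satisfies `(10584L³βρ³)⁴ > 4000⁴L²¹β`. [folklore] -/
theorem chartTransfer_wide_of_window {β T R R₀ ρ : ℝ} (hβ1 : 1 ≤ β) (hT0 : 0 ≤ T) (hT : T ≤ 1 / 30) (hTρ : 8 * T ≤ ρ) (hR0 : 0 ≤ R)
    (hR₀ : 6 * T ^ 2 * R ≤ R₀)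
    (hinfo : Fintype.card (Edge 3 L × Fin 3) * Real.log 2 + 98 * β * R ^ 2 < (min (ρ - 2 * T) (R₀ - 6 * T ^ 2 * R)) ^ 2 * β)
    (hAlo : 7 * min ρ (R₀ - R) ≤ 48 * R + 400 * T ^ 2) {D x : ℝ} (hD : 0 ≤ D) (hx : 0 ≤ x) :
    (4000 : ℝ) < (96 * (β / 2) + β) * (D * (2 * x + D) + 72 * Fintype.card (Edge 3 L) * ρ ^ 3) ∧
      (4000 : ℝ) ^ 4 * (L : ℝ) ^ 21 * β < (10584 * (L : ℝ) ^ 3 * β * ρ ^ 3) ^ 4 := by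
  have hβ : 0 < β := by linarith
  obtain ⟨-, -, hwin⟩ := window_euclid (L := L) hβ hT0 hT hTρ hR0 hR₀ hinfo hAlo
  exact ⟨(chartTransferEps_gt (L := L) hβ1 hT0 hTρ hwin).trans_le (chartTransferEps_le_full (L := L) hβ.le hD hx),
    chartTransferEps_pow_four_gt (L := L) hβ hT0 hTρ hwin⟩

/-- ★★★ **The same, from the glue's hypotheses verbatim**: `hΩt`, `hWc`, a centre `v′` with `‖linkEmbed v′‖ ≤ R`, `ρ ≤ 1/2`, `8T ≤ ρ`, `0 ≤ T ≤ 1/30`, `6T²R ≤ R₀`, `L ≥ 2`,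
`β ≥ 1`, and `hAlo` (as stated in `…central_transfer_two_sided_of_localisedAvg_local`) with a POSITIVE `gm`: if the lower constant is informative
(`|E×3|·log 2 + 98βR² < min(ρ−2T, R₀−6T²R)²β`), then the (4′) transfer exponent exceeds `4000` for all `D′, x ≥ 0` — the chart supplier's `hAhi`/`hAlo` constants
`e^{±(ε_q+ε_tr)}` differ by `> e^{8000}` — for EVERY admissible parameter choice. [folklore] -/
theorem chartTransfer_wide_of_hAlo {Ω : LinkSpace L → ℝ} {W : (Site 3 L → SU2) → ℝ} {T R Γ : ℝ}
    (hΩt : ∀ v : Edge 3 L → Fin 3 → ℝ, Ω (linkEmbed L v) ≠ 0 → v ∈ capBalancedSet L ∧ (∀ (e : Edge 3 L) (c : Fin 3), |v e c| ≤ T) ∧ ‖linkEmbed L v‖ ≤ R)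
    (hWc : ∀ g : Site 3 L → SU2, W g ≠ 0 → (∀ x, ‖su2Quat (g x) - 1‖ ≤ T) ∧ ‖∑ x, vecPart (g x)‖ ≤ Γ)
    (χ₀ : GaugeConfig 3 1 SU2 → ℝ) (hL : 2 ≤ L) {v' : Edge 3 L → Fin 3 → ℝ} (hx' : ‖linkEmbed L v'‖ ≤ R)
    {ρ R₀ : ℝ} (hρ2 : ρ ≤ 1 / 2) (hT0 : 0 ≤ T) (hT : T ≤ 1 / 30) (hTρ : 8 * T ≤ ρ) (hR₀ : 6 * T ^ 2 * R ≤ R₀)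
    {β : ℝ} (hβ1 : 1 ≤ β) {gm : ℝ} (hgm : 0 < gm)
    (hAlo : ∀ w : Edge 3 L → Fin 3 → ℝ, (∀ e, ∑ a, w e a ^ 2 ≤ ρ ^ 2) → ‖chartVec w - linkEmbed L v'‖ ≤ R₀ →
        gm * Real.exp (-stiffGaussExp L (β / 2) β (chartVec w)) ≤
          ∫ g, W g * boFun L χ₀ Ω (gaugeTransform g⁻¹ (latPatternChart L (fun _ => false) w)) ∂gaugeMeasure L)
    (hinfo : Fintype.card (Edge 3 L × Fin 3) * Real.log 2 + 98 * β * R ^ 2 < (min (ρ - 2 * T) (R₀ - 6 * T ^ 2 * R)) ^ 2 * β)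
    {D x : ℝ} (hD : 0 ≤ D) (hx : 0 ≤ x) :
    (4000 : ℝ) < (96 * (β / 2) + β) * (D * (2 * x + D) + 72 * Fintype.card (Edge 3 L) * ρ ^ 3) := by
  have hR0 : 0 ≤ R := (norm_nonneg _).trans hx'
  have hwin : 7 * min ρ (R₀ - R) ≤ 48 * R + 400 * T ^ 2 := by
    by_contra h
    push Not at h
    exact not_hAloLocal_glue_euclid hR0 hΩt hWc χ₀ hL hx' hρ2 (min_le_left _ _) (by linarith [min_le_right ρ (R₀ - R)]) h hgm hAlo
  exact (chartTransfer_wide_of_window (L := L) hβ1 hT0 hT hTρ hR0 hR₀ hinfo hwin hD hx).1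

/-! ## §4 No bite on the decoupled schedule: `ρ ≤ c/√β` gives `ε_tr`'s `ρ³` part `≤ 10584L³c³/√β → 0` -/

omit [NeZero L] in
/-- **Schedule-B size** (`ρ = c·β^{-1/2}`, e.g. `c = 60Lℓ²`): `10584·L³·β·ρ³ ≤ 10584·L³·c³/√β`. [folklore] -/
theorem chartTransferEps_le_of_schedule {β c ρ : ℝ} (hβ : 0 < β) (hρ0 : 0 ≤ ρ) (hρ : ρ ≤ c / Real.sqrt β) :
    10584 * (L : ℝ) ^ 3 * β * ρ ^ 3 ≤ 10584 * (L : ℝ) ^ 3 * c ^ 3 / Real.sqrt β := by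
  have hs : 0 < Real.sqrt β := Real.sqrt_pos.2 hβ
  have hss : Real.sqrt β ^ 2 = β := Real.sq_sqrt hβ.le
  have h3 : ρ ^ 3 ≤ (c / Real.sqrt β) ^ 3 := pow_le_pow_left₀ hρ0 hρ 3
  have hs3 : Real.sqrt β ^ 3 = β * Real.sqrt β := by rw [pow_succ, hss]
  have hc0 : (0 : ℝ) ≤ 10584 * (L : ℝ) ^ 3 * β := by positivity
  calc 10584 * (L : ℝ) ^ 3 * β * ρ ^ 3 ≤ 10584 * (L : ℝ) ^ 3 * β * (c / Real.sqrt β) ^ 3 := mul_le_mul_of_nonneg_left h3 hc0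
    _ = 10584 * (L : ℝ) ^ 3 * c ^ 3 / Real.sqrt β := by
        rw [div_pow, hs3]
        field_simp

end Summit.QuantumFields.YangMills.Theorems.TwistedTraceScaling.Negative.R48

end
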